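import Literature.Analysis.FluidPDE.KNSSLemma31Caloric
import Literature.Analysis.FluidPDE.KNSSLemma31Liouville
import Literature.Analysis.FluidPDE.NSBoundedMildOseenDuhamel
import Literature.Analysis.FluidPDE.NSBoundedMildOseenClassical
import Literature.Analysis.FluidPDE.OseenHeatWeakDiv
import Literature.Analysis.FluidPDE.OseenHeatDuality
import Mathlib.Analysis.Calculus.BumpFunction.Convolution
import HarnessLib

/-!
# KNSS 2009, Lemma 3.1 by duality, III: bounded weak solutions of the homogeneous Stokes system
# are caloric up to constants

Third layer of the duality proof of Lemma 3.1 of Koch–Nadirashvili–Seregin–Šverák, *Liouville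
theorems for the Navier–Stokes equations and applications*, Acta Math. **203** (2009) 83–105
(arXiv:0709.3599v1, §3 p. 7), case `f = 0`: *a bounded weak solution of the linear Stokes system
in `ℝⁿ × (0, T)` is of the form `u = w + b(t)` with `w` the caloric extension and `b` bounded* — here
in the two-time form adapted to merely measurable-in-time fields: off a null set of times,
`z(t) = e^{(t-s)Δ} z(s) + β(s, t)` a.e. in space (`exists_ae_eq_heatExtension_add_const_of_weakStokes`).

The printed proof mollifies in space–time, subtracts the caloric extension, observes that the
vorticity of the difference solves the heat equation with zero data and vanishes, and concludes by
Liouville's theorem and a limit `ε → 0`. The formal proof replaces mollification by duality: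

* `integral_inner_caloricCurlPair_eq_neg_integral_mul`: the caloric vorticity pairing of layer I,
  `∫ ⟪h, (D(e^{rΔ}g) a) c − (D(e^{rΔ}g) c) a⟫`, equals `−∫ g · (⟪D(e^{rΔ}h) a, c⟫ − ⟪D(e^{rΔ}h) c, a⟫)`,
  the `g`-tested `(a, c)`-vorticity of the smooth field `e^{rΔ}h` (transposition of the heat flow,
  derivatives on the data, integration by parts);
* `inner_fderiv_comm_of_forall_integral_bump_mul_eq_zero`: a `C¹` field whose frame vorticity
  components are annihilated by all translates to a dense sequence of a shrinking sequence of
  normed bumps has symmetric Jacobian (approximate identity, Mathlib's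
  `ContDiffBump.convolution_tendsto_right_of_continuous`, and density);
* `heatExtension_sub_const_of_caloricVorticityPairing_eq`: if the pairings of two bounded weakly
  divergence-free slices `z(s)`, `z(t)` at a common later time agree on that countable family, then
  `e^{(q-t)Δ}(z(t) − e^{(t-s)Δ}z(s))` is constant in space (layer II Liouville theorem
  `apply_eq_apply_of_symm_fderiv_of_isDivFree_of_bounded`);
* `exists_ae_eq_heatExtension_add_const_of_weakStokes`: the two-time identity, from layer I
  (`exists_ae_eq_const_caloricVorticityPairing`, constancy of the pairings for a.e. time) on a
  countable family of tests and rational later times, and layer II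
  (`exists_ae_eq_const_of_heatExtension_eq_const`) along rational `qₙ ↓ t`.

## References

* [KochNadirashviliSereginSverak2009] H. Koch, N. Nadirashvili, G. Seregin, V. Šverák, *Liouville
  theorems for the Navier–Stokes equations and applications*, Acta Math. 203 (2009), 83–105,
  doi:10.1007/s11511-009-0039-6, arXiv:0709.3599 — Lemma 3.1 and its proof, p. 7.
-/

open MeasureTheory TopologicalSpace Set Function Filter Topology InnerProductSpace Metric
open scoped RealInnerProductSpace ENNReal NNReal ContDiff Laplacian Convolution

noncomputable section

namespace Literature.Analysis.FluidPDE

variable {E : Type*} [NormedAddCommGroup E] [InnerProductSpace ℝ E] [FiniteDimensional ℝ E]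
  [MeasurableSpace E] [BorelSpace E]

/-! ### The caloric vorticity pairing is the tested vorticity of the caloric extension -/

section PerTime

/-- **The caloric vorticity pairing is the tested vorticity of the caloric extension**: for `h`
bounded measurable, `g ∈ C^∞_c`, `a, c ∈ E` and `r > 0`,
`∫ ⟪h, (D(e^{rΔ}g) a) c − (D(e^{rΔ}g) c) a⟫ = −∫ g (⟪D(e^{rΔ}h) a, c⟫ − ⟪D(e^{rΔ}h) c, a⟫)`:
the test field is `e^{rΔ}(𝐋 ∘ Dg)` with `𝐋ℓ = ℓ(a)c − ℓ(c)a` (derivatives fall on the data and the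
heat flow commutes with `𝐋`), the heat flow is transposed onto `h`
(`integral_inner_heatExtension_comm_of_bound`), and one integrates by parts against `g`
(`integral_fderiv_mul_eq_neg_of_hasCompactSupport`). This is the unmollified form of
"`curl w_ε`, where `w_ε` is the caloric extension of `u_ε(·, t)`" in the proof of Lemma 3.1.
[cite: KochNadirashviliSereginSverak2009, Lemma 3.1, proof (arXiv:0709.3599v1 p. 7)] -/
theorem integral_inner_caloricCurlPair_eq_neg_integral_mul {h : E → E}
    (hh : AEStronglyMeasurable h volume) {Z : ℝ} (hZ : ∀ x, ‖h x‖ ≤ Z) {g : E → ℝ}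
    (hg : ContDiff ℝ ∞ g) (hgc : HasCompactSupport g) (a c : E) {r : ℝ} (hr : 0 < r) :
    ∫ x, ⟪h x, (fderiv ℝ (UnboundedOperators.heatExtension g r) x a) • c -
        (fderiv ℝ (UnboundedOperators.heatExtension g r) x c) • a⟫ =
      -∫ x, g x * (⟪fderiv ℝ (UnboundedOperators.heatExtension h r) x a, c⟫ -
        ⟪fderiv ℝ (UnboundedOperators.heatExtension h r) x c, a⟫) := by
  haveI : CompleteSpace E := FiniteDimensional.complete ℝ E
  have hg1 : ContDiff ℝ 1 g := hg.of_le (by exact_mod_cast le_top)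
  have hDg : Continuous (fderiv ℝ g) := hg1.continuous_fderiv one_ne_zero
  have hDgc : HasCompactSupport (fderiv ℝ g) := hgc.fderiv ℝ
  set Lm : (E →L[ℝ] ℝ) →L[ℝ] E := ((ContinuousLinearMap.apply ℝ ℝ a).smulRight c -
    (ContinuousLinearMap.apply ℝ ℝ c).smulRight a) with hLm_def
  have hLm : ∀ ℓ : E →L[ℝ] ℝ, Lm ℓ = ℓ a • c - ℓ c • a := fun ℓ => by simp [hLm_def]
  -- the test vector is the caloric extension of `w = 𝐋 ∘ Dg`
  set w : E → E := fun y => Lm (fderiv ℝ g y) with hw_def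
  have hw : Continuous w := Lm.continuous.comp hDg
  have hwc : HasCompactSupport w := hDgc.comp_left (map_zero Lm)
  have e1 : ∀ x, (fderiv ℝ (UnboundedOperators.heatExtension g r) x a) • c -
      (fderiv ℝ (UnboundedOperators.heatExtension g r) x c) • a =
      UnboundedOperators.heatExtension w r x := fun x => by
    rw [← hLm, UnboundedOperators.fderiv_heatExtension_of_hasCompactSupport hg1 hgc r x,
      ← UnboundedOperators.heatExtension_clm_comp Lm hDg hDgc r x]
  simp_rw [e1]
  rw [← integral_inner_heatExtension_comm_of_bound hh hZ hw hwc hr]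
  -- expand `⟪W, 𝐋(Dg)⟫` and integrate by parts
  set W : E → E := UnboundedOperators.heatExtension h r with hW_def
  have hW : ContDiff ℝ 1 W := (UnboundedOperators.contDiff_heatExtension_holds
    (memLp_top_of_bound hh Z (Eventually.of_forall hZ)) le_top hr).of_le (by exact_mod_cast le_top)
  have hWd : ∀ x, DifferentiableAt ℝ W x := fun x => hW.differentiable one_ne_zero x
  have hDW : Continuous (fderiv ℝ W) := hW.continuous_fderiv one_ne_zero
  have hΦ : ∀ v : E, ContDiff ℝ 1 fun x => ⟪W x, v⟫ := fun v => hW.inner ℝ contDiff_const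
  have hΦ' : ∀ v x u, fderiv ℝ (fun x => ⟪W x, v⟫) x u = ⟪fderiv ℝ W x u, v⟫ := fun v x u => by
    rw [fderiv_inner_apply ℝ (hWd x) (differentiableAt_const v)]
    simp
  have e2 : ∀ x, ⟪W x, w x⟫ = fderiv ℝ g x a * ⟪W x, c⟫ - fderiv ℝ g x c * ⟪W x, a⟫ := fun x => by
    show ⟪W x, Lm (fderiv ℝ g x)⟫ = _
    rw [hLm, inner_sub_right, real_inner_smul_right, real_inner_smul_right]
  simp_rw [e2]
  -- integrability of the products (continuous, compactly supported)
  have hDguc : ∀ u : E, HasCompactSupport fun x => fderiv ℝ g x u := fun u =>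
    hDgc.comp_left (g := fun L : E →L[ℝ] ℝ => L u) (by simp)
  have hi1 : ∀ u v : E, Integrable fun x => fderiv ℝ g x u * ⟪W x, v⟫ := fun u v =>
    ((hDg.clm_apply continuous_const).mul (hW.continuous.inner continuous_const))
      |>.integrable_of_hasCompactSupport (hDguc u).mul_right
  have hi2 : ∀ u v : E, Integrable fun x => g x * ⟪fderiv ℝ W x u, v⟫ := fun u v =>
    (hg.continuous.mul ((hDW.clm_apply continuous_const).inner continuous_const))
      |>.integrable_of_hasCompactSupport hgc.mul_right
  have e3 : ∀ u v : E, ∫ x, fderiv ℝ g x u * ⟪W x, v⟫ = -∫ x, g x * ⟪fderiv ℝ W x u, v⟫ := by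
    intro u v
    have h := integral_fderiv_mul_eq_neg_of_hasCompactSupport (hΦ v) hg1 hgc u
    simp_rw [hΦ'] at h
    calc ∫ x, fderiv ℝ g x u * ⟪W x, v⟫ = ∫ x, ⟪W x, v⟫ * fderiv ℝ g x u :=
          integral_congr_ae (Eventually.of_forall fun x => mul_comm _ _)
      _ = -∫ x, ⟪fderiv ℝ W x u, v⟫ * g x := neg_eq_iff_eq_neg.1 h.symm
      _ = -∫ x, g x * ⟪fderiv ℝ W x u, v⟫ := by
          congr 1
          exact integral_congr_ae (Eventually.of_forall fun x => mul_comm _ _)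
  rw [integral_sub (hi1 a c) (hi1 c a), e3 a c, e3 c a]
  simp_rw [mul_sub]
  rw [integral_sub (hi2 a c) (hi2 c a)]
  ring

end PerTime

/-! ### Symmetric Jacobian from vanishing bump-tested frame vorticities -/

section Bumps

/-- **A `C¹` field whose frame vorticity components are annihilated by all small bumps at a dense
sequence has symmetric Jacobian**: if
`∫ φₘ(pₙ − x) (⟪DV(x)eⱼ, eₖ⟫ − ⟪DV(x)eₖ, eⱼ⟫) dx = 0` for all `m, n, j, k`, where `(pₙ)` is dense and
the normed bumps `φₘ` have outer radii `→ 0`, then `⟪DV(x)a, c⟫ = ⟪DV(x)c, a⟫` for all `x, a, c`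
(the pairings converge to the continuous vorticity component at `pₙ`,
`ContDiffBump.convolution_tendsto_right_of_continuous`; a continuous function vanishing on a dense
set vanishes; bilinearity over the frame). [folklore] -/
theorem inner_fderiv_comm_of_forall_integral_bump_mul_eq_zero {V : E → E} (hV : ContDiff ℝ 1 V)
    {p : ℕ → E} (hp : DenseRange p) {φ : ℕ → ContDiffBump (0 : E)}
    (hφ : Tendsto (fun m => (φ m).rOut) atTop (𝓝 0))
    (h0 : ∀ (m n : ℕ) (j k : Fin (Module.finrank ℝ E)),
      ∫ x, (φ m).normed volume (p n - x) *
        (⟪fderiv ℝ V x (stdOrthonormalBasis ℝ E j), stdOrthonormalBasis ℝ E k⟫ -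
          ⟪fderiv ℝ V x (stdOrthonormalBasis ℝ E k), stdOrthonormalBasis ℝ E j⟫) = 0)
    (x a c : E) : ⟪fderiv ℝ V x a, c⟫ = ⟪fderiv ℝ V x c, a⟫ := by
  set b := stdOrthonormalBasis ℝ E
  set vort : Fin (Module.finrank ℝ E) → Fin (Module.finrank ℝ E) → E → ℝ := fun j k y =>
    ⟪fderiv ℝ V y (b j), b k⟫ - ⟪fderiv ℝ V y (b k), b j⟫ with hvort
  have hDV : Continuous (fderiv ℝ V) := hV.continuous_fderiv one_ne_zero
  have hvortc : ∀ j k, Continuous (vort j k) := fun j k =>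
    ((hDV.clm_apply continuous_const).inner continuous_const).sub
      ((hDV.clm_apply continuous_const).inner continuous_const)
  -- `vort j k` vanishes on the dense sequence, hence everywhere
  have hvortp : ∀ j k n, vort j k (p n) = 0 := by
    intro j k n
    have hlim := ContDiffBump.convolution_tendsto_right_of_continuous (μ := volume) hφ (hvortc j k) (p n)
    have hzero : ∀ m, ((φ m).normed volume ⋆[ContinuousLinearMap.lsmul ℝ ℝ, volume] vort j k) (p n) =
        0 := by
      intro m
      rw [convolution_lsmul_swap]
      simp_rw [smul_eq_mul]
      exact h0 m n j k
    simp_rw [hzero] at hlim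
    exact tendsto_nhds_unique hlim tendsto_const_nhds
  have hvort0 : ∀ j k y, vort j k y = 0 := by
    intro j k
    have hfun : vort j k = fun _ => 0 :=
      Continuous.ext_on hp (hvortc j k) continuous_const (by rintro _ ⟨n, rfl⟩; exact hvortp j k n)
    exact fun y => congrFun hfun y
  -- recombine over the frame
  have e1 : ⟪fderiv ℝ V x a, c⟫ = ∑ i, ∑ j, ⟪a, b j⟫ * ⟪c, b i⟫ * ⟪fderiv ℝ V x (b j), b i⟫ := by
    rw [sum_sum_inner_mul_inner_mul_inner_apply, real_inner_comm]
  have e2 : ⟪fderiv ℝ V x c, a⟫ = ∑ i, ∑ j, ⟪a, b j⟫ * ⟪c, b i⟫ * ⟪fderiv ℝ V x (b i), b j⟫ := by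
    rw [← real_inner_comm (fderiv ℝ V x c) a, ← sum_sum_inner_mul_inner_mul_inner_apply (fderiv ℝ V x) c a]
    exact Finset.sum_comm.trans (Finset.sum_congr rfl fun i _ => Finset.sum_congr rfl fun j _ => by ring)
  rw [e1, e2, ← sub_eq_zero, ← Finset.sum_sub_distrib]
  refine Finset.sum_eq_zero fun i _ => ?_
  rw [← Finset.sum_sub_distrib]
  refine Finset.sum_eq_zero fun j _ => ?_
  rw [← mul_sub]
  have h := hvort0 j i x
  simp only [hvort] at h
  rw [h, mul_zero]

end Bumps

/-! ### Two slices with matching pairings differ by a caloric extension and a constant -/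

section TwoSlices

/-- **Matching caloric vorticity pairings force `e^{ρₜΔ}(z_t − e^{(ρₛ−ρₜ)Δ}z_s)` to be constant.**
Let `z_s, z_t` be bounded, measurable, weakly divergence-free fields and `0 < ρₜ < ρₛ`. If for all
members `g = φₘ(pₙ − ·)` of the countable bump family and all frame pairs `(eⱼ, eₖ)` the caloric
vorticity pairings of `z_s` at time-lag `ρₛ` and of `z_t` at time-lag `ρₜ` agree, then the field
`Y = e^{ρₛΔ}z_s − e^{ρₜΔ}z_t` is smooth, bounded, divergence free
(`IsWeaklyDivFree.heatExtension_of_bound`, `IsWeaklyDivFree.isDivFree_of_contDiff`) with symmetric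
Jacobian (`inner_fderiv_comm_of_forall_integral_bump_mul_eq_zero`), hence constant
(`apply_eq_apply_of_symm_fderiv_of_isDivFree_of_bounded`); by the semigroup law
`e^{ρₜΔ}(z_t − e^{(ρₛ−ρₜ)Δ}z_s) = −Y`. This is "`Δ(u(t₁) − u(t₂)) = 0` and the Liouville theorem
for bounded harmonic functions implies `u(x, t₁) − u(x, t₂) = b`" of the printed proof, one heat
flow away from the slices. [cite: KochNadirashviliSereginSverak2009, Lemma 3.1, proof (arXiv:0709.3599v1 p. 7)] -/
theorem heatExtension_sub_const_of_caloricVorticityPairing_eq {zs zt : E → E}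
    (hzs : AEStronglyMeasurable zs volume) (hzt : AEStronglyMeasurable zt volume) {Z : ℝ}
    (hZs : ∀ x, ‖zs x‖ ≤ Z) (hZt : ∀ x, ‖zt x‖ ≤ Z) (hdivs : IsWeaklyDivFree zs)
    (hdivt : IsWeaklyDivFree zt) {ρs ρt : ℝ} (hρt : 0 < ρt) (hρ : ρt < ρs) {p : ℕ → E}
    (hp : DenseRange p) {φ : ℕ → ContDiffBump (0 : E)}
    (hφ : Tendsto (fun m => (φ m).rOut) atTop (𝓝 0))
    (hΛ : ∀ (m n : ℕ) (j k : Fin (Module.finrank ℝ E)),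
      ∫ x, ⟪zs x, (fderiv ℝ (UnboundedOperators.heatExtension
          (fun y => (φ m).normed volume (p n - y)) ρs) x (stdOrthonormalBasis ℝ E j)) •
            stdOrthonormalBasis ℝ E k -
        (fderiv ℝ (UnboundedOperators.heatExtension
          (fun y => (φ m).normed volume (p n - y)) ρs) x (stdOrthonormalBasis ℝ E k)) •
            stdOrthonormalBasis ℝ E j⟫ =
      ∫ x, ⟪zt x, (fderiv ℝ (UnboundedOperators.heatExtension
          (fun y => (φ m).normed volume (p n - y)) ρt) x (stdOrthonormalBasis ℝ E j)) •
            stdOrthonormalBasis ℝ E k -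
        (fderiv ℝ (UnboundedOperators.heatExtension
          (fun y => (φ m).normed volume (p n - y)) ρt) x (stdOrthonormalBasis ℝ E k)) •
            stdOrthonormalBasis ℝ E j⟫)
    (x y : E) :
    UnboundedOperators.heatExtension (zt - UnboundedOperators.heatExtension zs (ρs - ρt)) ρt x =
      UnboundedOperators.heatExtension (zt - UnboundedOperators.heatExtension zs (ρs - ρt)) ρt y := by
  haveI : CompleteSpace E := FiniteDimensional.complete ℝ E
  set b := stdOrthonormalBasis ℝ E
  have hρs : 0 < ρs := hρt.trans hρ
  have hδ : 0 < ρs - ρt := sub_pos.2 hρ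
  have hzsM : MemLp zs ∞ (volume : Measure E) := memLp_top_of_bound hzs Z (Eventually.of_forall hZs)
  have hztM : MemLp zt ∞ (volume : Measure E) := memLp_top_of_bound hzt Z (Eventually.of_forall hZt)
  -- the two caloric extensions at the common later time
  set Ws : E → E := UnboundedOperators.heatExtension zs ρs with hWs_def
  set Wt : E → E := UnboundedOperators.heatExtension zt ρt with hWt_def
  have hWs : ContDiff ℝ ∞ Ws := UnboundedOperators.contDiff_heatExtension_holds hzsM le_top hρs
  have hWt : ContDiff ℝ ∞ Wt := UnboundedOperators.contDiff_heatExtension_holds hztM le_top hρt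
  have hWs1 : ContDiff ℝ 1 Ws := hWs.of_le (by exact_mod_cast le_top)
  have hWt1 : ContDiff ℝ 1 Wt := hWt.of_le (by exact_mod_cast le_top)
  have hWsb : ∀ x, ‖Ws x‖ ≤ Z := UnboundedOperators.norm_heatExtension_le hZs hρs
  have hWtb : ∀ x, ‖Wt x‖ ≤ Z := UnboundedOperators.norm_heatExtension_le hZt hρt
  have hWsdiv : VectorCalculus.IsDivFree Ws :=
    (hdivs.heatExtension_of_bound hzs hZs hρs).isDivFree_of_contDiff hWs1
  have hWtdiv : VectorCalculus.IsDivFree Wt :=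
    (hdivt.heatExtension_of_bound hzt hZt hρt).isDivFree_of_contDiff hWt1
  -- their difference `Y`
  set Y : E → E := fun x => Ws x - Wt x with hY_def
  have hY : ContDiff ℝ ∞ Y := hWs.sub hWt
  have hY2 : ContDiff ℝ 2 Y := hY.of_le (by norm_cast)
  have hY1 : ContDiff ℝ 1 Y := hY.of_le (by exact_mod_cast le_top)
  have hYb : ∀ x, ‖Y x‖ ≤ Z + Z := fun x => (norm_sub_le _ _).trans (add_le_add (hWsb x) (hWtb x))
  have hDY : ∀ x, fderiv ℝ Y x = fderiv ℝ Ws x - fderiv ℝ Wt x := fun x =>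
    fderiv_sub ((hWs1.differentiable one_ne_zero) x) ((hWt1.differentiable one_ne_zero) x)
  have hYdiv : VectorCalculus.IsDivFree Y := fun x => by
    have h1 := hWsdiv x
    have h2 := hWtdiv x
    simp only [VectorCalculus.divergence] at h1 h2 ⊢
    rw [hDY x, ContinuousLinearMap.toLinearMap_sub, map_sub, h1, h2, sub_zero]
  -- the Jacobian of `Y` is symmetric: its frame vorticities are annihilated by the bump family
  have hsymm : ∀ x a c, ⟪fderiv ℝ Y x a, c⟫ = ⟪fderiv ℝ Y x c, a⟫ := by
    refine inner_fderiv_comm_of_forall_integral_bump_mul_eq_zero hY1 hp hφ fun m n j k => ?_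
    set g : E → ℝ := fun y => (φ m).normed volume (p n - y) with hg_def
    have hg : ContDiff ℝ ∞ g := (φ m).contDiff_normed.comp (contDiff_const.sub contDiff_id)
    have hgc : HasCompactSupport g :=
      ((φ m).hasCompactSupport_normed (μ := volume)).comp_homeomorph (Homeomorph.subLeft (p n))
    have hs := integral_inner_caloricCurlPair_eq_neg_integral_mul hzs hZs hg hgc (b j) (b k) hρs
    have ht := integral_inner_caloricCurlPair_eq_neg_integral_mul hzt hZt hg hgc (b j) (b k) hρt
    have hjk : (∫ x, ⟪zs x, (fderiv ℝ (UnboundedOperators.heatExtension g ρs) x (b j)) • b k -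
        (fderiv ℝ (UnboundedOperators.heatExtension g ρs) x (b k)) • b j⟫) =
        ∫ x, ⟪zt x, (fderiv ℝ (UnboundedOperators.heatExtension g ρt) x (b j)) • b k -
          (fderiv ℝ (UnboundedOperators.heatExtension g ρt) x (b k)) • b j⟫ := hΛ m n j k
    rw [hs, ht, neg_inj] at hjk
    -- integrability (continuous integrands against the compactly supported `g`)
    have hint : ∀ {W : E → E}, ContDiff ℝ 1 W →
        Integrable fun x => g x * (⟪fderiv ℝ W x (b j), b k⟫ - ⟪fderiv ℝ W x (b k), b j⟫) :=
      fun hW => (hg.continuous.mul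
        ((((hW.continuous_fderiv one_ne_zero).clm_apply continuous_const).inner continuous_const).sub
        (((hW.continuous_fderiv one_ne_zero).clm_apply continuous_const).inner continuous_const)))
        |>.integrable_of_hasCompactSupport hgc.mul_right
    rw [← sub_eq_zero, ← integral_sub (hint hWs1) (hint hWt1)] at hjk
    have hY' : ∀ x, (φ m).normed volume (p n - x) *
        (⟪fderiv ℝ Y x (b j), b k⟫ - ⟪fderiv ℝ Y x (b k), b j⟫) =
        g x * (⟪fderiv ℝ Ws x (b j), b k⟫ - ⟪fderiv ℝ Ws x (b k), b j⟫) -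
          g x * (⟪fderiv ℝ Wt x (b j), b k⟫ - ⟪fderiv ℝ Wt x (b k), b j⟫) := fun x => by
      rw [hDY x, FunLike.coe_sub, Pi.sub_apply, Pi.sub_apply, inner_sub_left,
        inner_sub_left]
      ring
    exact (integral_congr_ae (Eventually.of_forall hY')).trans hjk
  -- Liouville: `Y` is constant
  have hYc := apply_eq_apply_of_symm_fderiv_of_isDivFree_of_bounded hY2 hsymm hYdiv hYb x y
  -- `e^{ρₜΔ}(z_t − e^{(ρₛ−ρₜ)Δ}z_s) = W_t − W_s = −Y`
  have hw : MemLp (UnboundedOperators.heatExtension zs (ρs - ρt)) ∞ (volume : Measure E) :=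
    memLp_top_of_bound
      (UnboundedOperators.contDiff_heatExtension_holds hzsM le_top hδ).continuous.aestronglyMeasurable
      Z (Eventually.of_forall (UnboundedOperators.norm_heatExtension_le hZs hδ))
  have hsub := heatExtension_sub_eq_of_memLp hztM hw le_top hρt
  have hsg : UnboundedOperators.heatExtension (UnboundedOperators.heatExtension zs (ρs - ρt)) ρt =
      Ws := by
    rw [hWs_def, UnboundedOperators.heatExtension_add_holds hzsM le_top hδ hρt, sub_add_cancel]
  have hval : ∀ x, UnboundedOperators.heatExtension
      (zt - UnboundedOperators.heatExtension zs (ρs - ρt)) ρt x = -(Y x) := fun x => by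
    rw [hsub, Pi.sub_apply, hsg, hY_def, neg_sub]
  rw [hval x, hval y, hYc]

end TwoSlices

/-! ### The two-time identity for bounded weak solutions of the homogeneous Stokes system -/

section Main

/-- **Bounded weak solutions of the homogeneous Stokes system are caloric up to constants**
(KNSS 2009, Lemma 3.1 with `f = 0`, two-time form). Let `z` be jointly measurable on
`(0, T) × E`, bounded by `Z`, weakly divergence free at a.e. time, and a weak solution of the
homogeneous Stokes system: `∫₀ᵀ ∫ ⟪z, ∂ₜψ + Δψ⟫ = 0` for every divergence-free space–time test
field `ψ` on the slab. Then there is a set `G ⊆ (0, T)` of full measure of times, at which the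
slices are measurable and weakly divergence free, such that for all `s < t` in `G`,
`z(t) = e^{(t−s)Δ} z(s) + β` a.e. in space for some constant vector `β = β(s, t)`.

`G` collects the Lebesgue-type points of countably many a.e. statements: the constancy in time
of the caloric vorticity pairings (`exists_ae_eq_const_caloricVorticityPairing`) for the bump family
`φₘ(pₙ − ·)`, the frame pairs, and all rational later times `q`. For `s < t` in `G` and rational
`q ∈ (t, T)` the pairings of `z(s)` and `z(t)` at time `q` agree, so `e^{(q−t)Δ}(z(t) − e^{(t−s)Δ}z(s))`
is constant (`heatExtension_sub_const_of_caloricVorticityPairing_eq`); letting `q ↓ t` through the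
rationals, `z(t) − e^{(t−s)Δ}z(s)` is a.e. constant (`exists_ae_eq_const_of_heatExtension_eq_const`).
In the source: "the bounded weak solution of the heat equation is of the form `u = w + b(t)`"
(applied between two times). [cite: KochNadirashviliSereginSverak2009, Lemma 3.1 (case `f = 0`), proof p. 7 (arXiv:0709.3599v1)] -/
theorem exists_ae_eq_heatExtension_add_const_of_weakStokes {T Z : ℝ} {z : ℝ → E → E}
    (hzm : AEStronglyMeasurable (uncurry z) ((volume.restrict (Ioo 0 T)).prod (volume : Measure E)))
    (hZ : ∀ t ∈ Ioo 0 T, ∀ x, ‖z t x‖ ≤ Z)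
    (hdiv : ∀ᵐ t ∂(volume.restrict (Ioo 0 T)), IsWeaklyDivFree (z t))
    (hweak : ∀ ψ : ℝ → E → E, IsSpaceTimeTestOn (slab E (Ioo 0 T) isOpen_Ioo) ψ →
      (∀ t, VectorCalculus.IsDivFree (ψ t)) →
      ∫ t in Ioo 0 T, ∫ x, ⟪z t x, timeDeriv ψ t x + Δ (ψ t) x⟫ = 0) :
    ∃ G : Set ℝ, G ⊆ Ioo 0 T ∧ volume (Ioo 0 T \ G) = 0 ∧
      (∀ t ∈ G, AEStronglyMeasurable (z t) volume) ∧ (∀ t ∈ G, IsWeaklyDivFree (z t)) ∧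
      ∀ s ∈ G, ∀ t ∈ G, s < t → ∃ β : E,
        z t =ᵐ[volume] fun x => UnboundedOperators.heatExtension (z s) (t - s) x + β := by
  haveI : CompleteSpace E := FiniteDimensional.complete ℝ E
  haveI : Nonempty E := ⟨0⟩
  set d := Module.finrank ℝ E
  set b := stdOrthonormalBasis ℝ E
  -- a dense sequence and shrinking bumps
  set p : ℕ → E := TopologicalSpace.denseSeq E
  have hp : DenseRange p := TopologicalSpace.denseRange_denseSeq E
  set φ : ℕ → ContDiffBump (0 : E) := fun m =>
    ⟨1 / ((m : ℝ) + 2), 1 / ((m : ℝ) + 1), by positivity,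
      one_div_lt_one_div_of_lt (by positivity) (by linarith)⟩ with hφ_def
  have hφ : Tendsto (fun m => (φ m).rOut) atTop (𝓝 0) := tendsto_one_div_add_atTop_nhds_zero_nat
  set g : ℕ → ℕ → E → ℝ := fun m n y => (φ m).normed volume (p n - y) with hg_def
  have hg : ∀ m n, ContDiff ℝ ∞ (g m n) := fun m n =>
    (φ m).contDiff_normed.comp (contDiff_const.sub contDiff_id)
  have hgc : ∀ m n, HasCompactSupport (g m n) := fun m n =>
    ((φ m).hasCompactSupport_normed (μ := volume)).comp_homeomorph (Homeomorph.subLeft (p n))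
  -- the caloric vorticity pairings and their a.e. constant values
  set Λ : ℕ → ℕ → Fin d → Fin d → ℚ → ℝ → ℝ := fun m n j k q τ =>
    ∫ x, ⟪z τ x, (fderiv ℝ (UnboundedOperators.heatExtension (g m n) ((q : ℝ) - τ)) x (b j)) • b k -
      (fderiv ℝ (UnboundedOperators.heatExtension (g m n) ((q : ℝ) - τ)) x (b k)) • b j⟫ with hΛ_def
  have hB : ∀ (m n : ℕ) (j k : Fin d) (q : ℚ), ∃ κ : ℝ, ∀ᵐ τ : ℝ ∂(volume.restrict (Ioo 0 T)),
      (0 < (q : ℝ) ∧ (q : ℝ) ≤ T) → τ < (q : ℝ) → Λ m n j k q τ = κ := by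
    intro m n j k q
    by_cases hq : 0 < (q : ℝ) ∧ (q : ℝ) ≤ T
    · obtain ⟨κ, hκ⟩ := exists_ae_eq_const_caloricVorticityPairing hzm hZ hweak (hg m n) (hgc m n)
        (b j) (b k) hq.1 hq.2
      refine ⟨κ, ?_⟩
      have h1 := (ae_restrict_iff' (measurableSet_Ioo : MeasurableSet (Ioo (0 : ℝ) q))).1 hκ
      exact (ae_restrict_iff' measurableSet_Ioo).2
        (h1.mono fun τ hτ hτT _ hτq => hτ ⟨hτT.1, hτq⟩)
    · exact ⟨0, Eventually.of_forall fun τ h => (hq h).elim⟩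
  choose κ hκ using hB
  -- the good set of times
  have hslice : ∀ᵐ τ ∂(volume.restrict (Ioo 0 T)), AEStronglyMeasurable (z τ) volume :=
    hzm.prodMk_left
  have hall : ∀ᵐ τ : ℝ ∂(volume.restrict (Ioo 0 T)), ∀ (m n : ℕ) (j k : Fin d) (q : ℚ),
      (0 < (q : ℝ) ∧ (q : ℝ) ≤ T) → τ < (q : ℝ) → Λ m n j k q τ = κ m n j k q :=
    ae_all_iff.2 fun m => ae_all_iff.2 fun n => ae_all_iff.2 fun j => ae_all_iff.2 fun k =>
      ae_all_iff.2 fun q => hκ m n j k q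
  set G : Set ℝ := {τ | τ ∈ Ioo 0 T ∧ AEStronglyMeasurable (z τ) volume ∧ IsWeaklyDivFree (z τ) ∧
      ∀ (m n : ℕ) (j k : Fin d) (q : ℚ), (0 < (q : ℝ) ∧ (q : ℝ) ≤ T) → τ < (q : ℝ) →
        Λ m n j k q τ = κ m n j k q} with hG_def
  have hGae : ∀ᵐ τ ∂(volume.restrict (Ioo 0 T)), τ ∈ G := by
    filter_upwards [ae_restrict_mem measurableSet_Ioo, hslice, hdiv, hall] with τ h1 h2 h3 h4
    exact ⟨h1, h2, h3, h4⟩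
  refine ⟨G, fun τ hτ => hτ.1, ?_, fun t ht => ht.2.1, fun t ht => ht.2.2.1, ?_⟩
  · have h := (ae_restrict_iff' measurableSet_Ioo).1 hGae
    rw [ae_iff] at h
    exact measure_mono_null
      (fun τ (hτ : τ ∈ Ioo 0 T \ G) (h' : τ ∈ Ioo 0 T → τ ∈ G) => hτ.2 (h' hτ.1)) h
  intro s hs t ht hst
  obtain ⟨⟨hs0, hsT⟩, hsm, hsdiv, hsΛ⟩ := hs
  obtain ⟨⟨ht0, htT⟩, htm, htdiv, htΛ⟩ := ht
  have hts : 0 < t - s := sub_pos.2 hst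
  have hTt : 0 < T - t := sub_pos.2 htT
  -- rational later times `qₙ ↓ t`
  have hq : ∀ n : ℕ, ∃ q : ℚ, t < q ∧ (q : ℝ) < t + (T - t) / ((n : ℝ) + 1) := fun n =>
    exists_rat_btwn (lt_add_of_pos_right t (by positivity))
  choose qs hqs using hq
  have hqT : ∀ n, (qs n : ℝ) < T := fun n => by
    have h1 : (T - t) / ((n : ℝ) + 1) ≤ T - t :=
      div_le_self hTt.le (le_add_of_nonneg_left (Nat.cast_nonneg n))
    linarith [(hqs n).2]
  set r : ℕ → ℝ := fun n => (qs n : ℝ) - t with hr_def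
  have hr : ∀ n, 0 < r n := fun n => sub_pos.2 (hqs n).1
  have hr0 : Tendsto r atTop (𝓝 0) := by
    have hup : Tendsto (fun n : ℕ => (T - t) * (1 / ((n : ℝ) + 1))) atTop (𝓝 0) := by
      have h := tendsto_one_div_add_atTop_nhds_zero_nat.const_mul (T - t)
      rwa [mul_zero] at h
    refine tendsto_of_tendsto_of_tendsto_of_le_of_le tendsto_const_nhds hup (fun n => (hr n).le)
      fun n => ?_
    have := (hqs n).2
    show (qs n : ℝ) - t ≤ (T - t) * (1 / ((n : ℝ) + 1))
    rw [mul_one_div]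
    linarith
  -- the field `z t − e^{(t−s)Δ} z s` has constant caloric extensions along `rₙ`
  set w : E → E := UnboundedOperators.heatExtension (z s) (t - s) with hw_def
  have hzsM : MemLp (z s) ∞ (volume : Measure E) :=
    memLp_top_of_bound hsm Z (Eventually.of_forall (hZ s ⟨hs0, hsT⟩))
  have hwc : Continuous w :=
    (UnboundedOperators.contDiff_heatExtension_holds hzsM le_top hts).continuous
  have hwb : ∀ x, ‖w x‖ ≤ Z := UnboundedOperators.norm_heatExtension_le (hZ s ⟨hs0, hsT⟩) hts
  have hfm : AEStronglyMeasurable (z t - w) volume := htm.sub hwc.aestronglyMeasurable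
  have hfb : ∀ x, ‖(z t - w) x‖ ≤ Z + Z := fun x => by
    rw [Pi.sub_apply]
    exact (norm_sub_le _ _).trans (add_le_add (hZ t ⟨ht0, htT⟩ x) (hwb x))
  have key : ∀ n x y, UnboundedOperators.heatExtension (z t - w) (r n) x =
      UnboundedOperators.heatExtension (z t - w) (r n) y := by
    intro n x y
    have hq0 : 0 < ((qs n : ℚ) : ℝ) := ht0.trans (hqs n).1
    have h1 : ∀ m n' j k, Λ m n' j k (qs n) s = Λ m n' j k (qs n) t := fun m n' j k => by
      rw [hsΛ m n' j k (qs n) ⟨hq0, (hqT n).le⟩ (hst.trans (hqs n).1),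
        htΛ m n' j k (qs n) ⟨hq0, (hqT n).le⟩ (hqs n).1]
    have h := heatExtension_sub_const_of_caloricVorticityPairing_eq hsm htm (hZ s ⟨hs0, hsT⟩)
      (hZ t ⟨ht0, htT⟩) hsdiv htdiv (ρs := (qs n : ℝ) - s) (ρt := (qs n : ℝ) - t) (hr n)
      (by linarith) hp hφ (fun m n' j k => h1 m n' j k) x y
    rw [show (qs n : ℝ) - s - ((qs n : ℝ) - t) = t - s by ring] at h
    exact h
  obtain ⟨β, hβ⟩ := exists_ae_eq_const_of_heatExtension_eq_const hfm hfb hr hr0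
    (c := fun n => UnboundedOperators.heatExtension (z t - w) (r n) 0) fun n x => key n x 0
  refine ⟨β, ?_⟩
  filter_upwards [hβ] with x hx
  have hx' : z t x - w x = β := hx
  rw [sub_eq_iff_eq_add'] at hx'
  exact hx'

end Main

end Literature.Analysis.FluidPDE
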